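import Mathlib.RingTheory.Ideal.GoingUp
import Literature.NumberTheory.EllipticCurves.PastenSpectralDegreeProofs
import Literature.NumberTheory.EllipticCurves.PastenCongruenceModulusSizeProofs
import Literature.NumberTheory.EllipticCurves.NewformsCoeffFieldHolds
import Literature.NumberTheory.EllipticCurves.ModularCurveManinSemistableBridgeProofs
import Literature.NumberTheory.EllipticCurves.ModularParametrizationProofs
import Literature.NumberTheory.EllipticCurves.ModularParametrizationHoldsProofs
import HarnessLib

/-!
# Route IsogenyGlueCongruence — support item `DegreePrimeCongruence` (stmt-ABC-14828)

The item (support, fact-shaped; the modular input of the `K`-line of the route) reads: for every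
semistable elliptic `W/ℚ`, given by a globally minimal model of conductor `N = W.conductorNorm ℤ`,
there is a modular parametrisation datum `D` of `W` at level `N` such that every prime
`ℓ ∣ D.modularDegree` is either `≤ 163` or a *congruence prime* of the newform of `W` with another
newform, in exactly the hypothesis shape of `TorsionSharingPrimeBound`: a level `M ∣ N`, a newform
`g ∈ S₂(Γ₀(M))` (`IsNewform0 g ∧ ¬ IsNewformOf W g`), a subring `R ⊆ ℂ` containing every `aₙ(g)`, a
field `F` of characteristic `ℓ` and a ring map `φ : R → F` with `φ(a_p(g)) = a_p(W)` for all primes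
`p ∤ M N ℓ`.

This file PROVES the item's signature (verbatim, theorem `degreePrimeCongruence_of_facts`) from
three named facts of the tree, all glue being supplied here or by theorems of the tree:

1. `exists_isNewformOf` (`CuspFormLFunction.lean`) — modularity, BCDT 2001 Thm. A "Version `a_p`";
   with the tree's theorems `IsNewformOf.exists_maninConstant_modularDegree_holds` and
   `nonempty_modularParametrizationData_of_modularity` it yields a datum of `W`;
2. `PastenShimura2024_thm_5_5` (`PastenSpectralDegree.lean`) — `δ_{1,N} ∣ ∏_{P ≠ 𝕀_{[χ₀]}} η_{[χ₀]}(P)`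
   (Pasten 2024, Thm. 5.5); by the tree's `PastenShimura2024_thm_5_5_of_modularDegree_dvd_congruenceNumber`
   it follows from Ribet's theorem `modularDegree_dvd_congruenceNumber` (Agashe–Ribet–Stein 2012,
   Thm. 2.1), whence the variant `degreePrimeCongruence_of_ribet`;
3. `PastenShimura2024_minimalDegree_le_163_mul` (`PastenSpectralDegree.lean`) — the minimal
   parametrisation degree of a globally minimal curve of the class is `≤ 163 · δ_{1,N}`
   (Mazur 1978, Kenku 1982; reduced in `PastenSpectralDegreeIsogenyBoundProofs.lean` to the tree's
   `mazurKenku_exists_cyclic_isogeny` plus the integrality of rational multipliers into a Néron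
   lattice, Edixhoven 1991, Prop. 2).

Proof. *Datum branch* (`datumBranch_of_le_163_mul`): take a datum `D'` of `W` of minimal degree
(`exists_minimal_datum`) and an optimal datum `D₀` with the same newform `f`
(`ModularParametrizationData.exists_optimalDatum'`, of minimal degree in the whole class by
`modularDegree_le_of_isogenyMap_ker_eq_bot`); the degree formula
`deg D' = [Λ_W : c Λ_f] · deg D₀` (`modularDegree_eq_card_ker_mul`) and fact 3 give
`[Λ_W : c Λ_f] ≤ 163`, so a prime `ℓ ∣ deg D'` is `≤ 163` or divides `deg D₀ = δ_{1,N}`.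
*Congruence branch* (`congruenceBranch_of_thm_5_5`): by fact 2, `ℓ ∣ δ_{1,N}` divides some
`η_{[χ₀]}(P) = [ℤ : χ₀(P)]`, `P ≠ 𝕀_{[χ₀]}` a minimal prime of `𝕋 = ℤ[T_p : p ∤ N]`; `P` is the
eigen-ideal `ker χ` of an Atkin–Lehner form `[α_d] g`, `g` a newform of level `M`, `M d ∣ N`
(`exists_isNewform0_eigenIdeal_eq_of_mem_minimalPrimes`), with `χ(T_p) = a_p(g)` and
`χ₀(T_p) = a_p(W)` for `p ∤ N`; since `ℓ ∣ η ∣ χ₀(t)` for all `t ∈ P` (Pasten's Prop. 5.4,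
`heckeCongruenceModulus_dvd_of_mem`), the reduction of `χ₀` modulo `ℓ` factors through
`χ(𝕋) ≅ 𝕋/P`, and lying over in the ring `R` of algebraic integers of `ℂ` (integral over `𝕋` via
`χ`; it contains the `aₙ(g)`, `IsNewform0.isIntegral_coeff_holds`) produces a maximal ideal `Q`
above `ker(𝕋 → 𝔽_ℓ)`, `F = R/Q`, `φ(a_p(g)) = χ₀(T_p) = a_p(W)` (`exists_ringHom_charP_of_dvd`,
`exists_congruentNewform_of_dvd_heckeCongruenceModulus`); `g` is not the newform of `W`, else
`[α_d] g` and `f` would share all `T_p`-eigenvalues, `p ∤ N`, and `P = 𝕀_{[χ₀]}`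
(`eigenIdeal_eq_of_forall_heckeT_eq_smul`). Semistability is not used.

Status. The route decl `Summit.ABC.ABC.Theses.IsogenyGlueCongruence.DegreePrimeCongruence` is not
yet materialised in the route file (rev 8); the theorems here conclude in the item's signature
written out, and `degreePrimeCongruence_of_facts` becomes the route-decl statement by `unfold` once
it is. The item stays conditional on facts 1–3 (a `conditional-result`); nothing else is missing.

## References

* H. Pasten, *Shimura curves and the abc conjecture*, J. Number Theory 254 (2024), 214–335 =
  arXiv:1705.09251: §3 p. 13, §4.9–4.11 p. 16, §5.4 with Prop. 5.4 p. 17, Thm. 5.5 p. 18.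
  [PastenShimura2024]
* A. Agashe, K. A. Ribet, W. A. Stein, *The modular degree, congruence primes, and multiplicity
  one*, Springer 2012, doi:10.1007/978-1-4614-1260-1_2: §2.1, Thm. 2.1. [AgasheRibetStein2012]
* B. Mazur, *Rational isogenies of prime degree*, Invent. Math. 44 (1978): Thm. 1. [Mazur1978]
* C. Breuil, B. Conrad, F. Diamond, R. Taylor, J. Amer. Math. Soc. 14 (2001): Thm. A. [BCDTJAMS2001]
-/

-- `Summit.<Summit>.<Problem>` is the mandated summit-side namespace (CONVENTIONS §2); for the
-- single-conjunct summit `ABC` the two coincide, so the duplicate `ABC.ABC` is deliberate.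
set_option linter.dupNamespace false

noncomputable section

open scoped MatrixGroups ModularForm

open CongruenceSubgroup Literature.NumberTheory.EllipticCurves.ModularForms

namespace Summit.ABC.ABC.Theorems

/-! ### Commutative algebra: a congruence of characters modulo `ℓ` realised in a residue field -/

/-- **A congruence `χ ≡ χ₀ (mod ℓ)` of ring characters, realised by a ring map to a field of
characteristic `ℓ`.** Let `T` be a commutative ring which is module-finite over `ℤ`, `χ₀ : T → ℤ`
and `χ : T → ℂ` ring homomorphisms, and `ℓ` a prime with `ℓ ∣ χ₀(t)` for every `t ∈ ker χ` (i.e.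
`χ₀` reduced modulo `ℓ` factors through `χ(T) ≅ T / ker χ`). Then, with `R ⊆ ℂ` the ring of all
algebraic integers (it contains `χ(T)`), there are a field `F` of characteristic `ℓ` and a ring map
`φ : R → F` with `φ(χ(t)) = χ₀(t) mod ℓ` for all `t ∈ T`. Proof: the kernel `𝔪` of
`T → ℤ → ℤ/ℓ` is a maximal ideal containing `ker χ = ker (T → R)`; `R` is integral over `T`
(through `χ`), so a maximal ideal `Q` of `R` lies over `𝔪` (lying over,
`Ideal.exists_ideal_over_maximal_of_isIntegral`); take `F = R / Q`. [folklore] -/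
theorem exists_ringHom_charP_of_dvd {T : Type*} [CommRing T] [Module.Finite ℤ T]
    (χ₀ : T →+* ℤ) (χ : T →+* ℂ) {ℓ : ℕ} (hℓ : ℓ.Prime)
    (hdvd : ∀ t ∈ RingHom.ker χ, (ℓ : ℤ) ∣ χ₀ t) :
    ∃ (R : Subring ℂ) (F : Type) (_ : Field F) (_ : CharP F ℓ) (φ : R →+* F),
      (∀ z : ℂ, IsIntegral ℤ z → z ∈ R) ∧
      ∃ hχ : ∀ t, χ t ∈ R, ∀ t, φ ⟨χ t, hχ t⟩ = ((χ₀ t : ℤ) : F) := by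
  classical
  haveI : Fact ℓ.Prime := ⟨hℓ⟩
  -- the ring of algebraic integers in `ℂ`
  set R : Subring ℂ := (integralClosure ℤ ℂ).toSubring with hR
  have hmemR : ∀ z : ℂ, z ∈ R ↔ IsIntegral ℤ z := fun z ↦ by
    rw [hR, Subalgebra.mem_toSubring, mem_integralClosure_iff]
  haveI : Algebra.IsIntegral ℤ T := Algebra.IsIntegral.of_finite ℤ T
  have hχR : ∀ t, χ t ∈ R := fun t ↦
    (hmemR _).mpr ((Algebra.IsIntegral.isIntegral (R := ℤ) t).map χ.toIntAlgHom)
  -- `R` as a `T`-algebra through `χ`; it is integral over `T`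
  let χR : T →+* R := χ.codRestrict R hχR
  letI : Algebra T R := χR.toAlgebra
  have halg : ∀ t : T, algebraMap T R t = ⟨χ t, hχR t⟩ := fun _ ↦ rfl
  haveI : Algebra.IsIntegral T R := ⟨fun x ↦ by
    have hxZ : IsIntegral ℤ (x : ℂ) := (hmemR x).mp x.2
    have hxZ' : IsIntegral ℤ x :=
      (isIntegral_algHom_iff R.subtype.toIntAlgHom Subtype.val_injective).mp hxZ
    exact hxZ'.tower_top⟩
  -- the maximal ideal `𝔪 = ker (T → ℤ → ℤ/ℓ)` contains `ker χ`
  let π : T →+* ZMod ℓ := (Int.castRingHom (ZMod ℓ)).comp χ₀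
  have hπ : Function.Surjective π := ZMod.ringHom_surjective π
  set 𝔪 : Ideal T := RingHom.ker π with h𝔪def
  haveI h𝔪 : 𝔪.IsMaximal := RingHom.ker_isMaximal_of_surjective π hπ
  have hker : RingHom.ker (algebraMap T R) ≤ 𝔪 := by
    intro t ht
    rw [RingHom.mem_ker, halg] at ht
    have ht' : χ t = 0 := congrArg (fun x : R ↦ (x : ℂ)) ht
    obtain ⟨c, hc⟩ := hdvd t ht'
    rw [h𝔪def, RingHom.mem_ker, RingHom.comp_apply, hc, map_mul, map_natCast, ZMod.natCast_self,
      zero_mul]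
  obtain ⟨Q, hQmax, hQ⟩ := Ideal.exists_ideal_over_maximal_of_isIntegral 𝔪 hker
  haveI := hQmax
  have hmemQ : ∀ t ∈ 𝔪, algebraMap T R t ∈ Q := fun t ht ↦ by
    rw [← Ideal.mem_comap, hQ]
    exact ht
  refine ⟨R, R ⧸ Q, Ideal.Quotient.field Q, ?_, Ideal.Quotient.mk Q,
    fun z hz ↦ (hmemR z).mpr hz, hχR, fun t ↦ ?_⟩
  · -- characteristic `ℓ`
    refine (CharP.charP_iff_prime_eq_zero hℓ).mpr ?_
    have hℓ𝔪 : (ℓ : T) ∈ 𝔪 := by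
      rw [h𝔪def, RingHom.mem_ker, map_natCast, ZMod.natCast_self]
    have h := Ideal.Quotient.eq_zero_iff_mem.mpr (hmemQ _ hℓ𝔪)
    rwa [map_natCast, map_natCast] at h
  · -- `φ (χ t) = χ₀ t`
    have ht𝔪 : t - ((χ₀ t : ℤ) : T) ∈ 𝔪 := by
      rw [h𝔪def, RingHom.mem_ker, map_sub, RingHom.comp_apply, RingHom.comp_apply, map_intCast,
        Int.cast_id, sub_self]
    have h := Ideal.Quotient.eq_zero_iff_mem.mpr (hmemQ _ ht𝔪)
    rw [map_sub, map_sub, map_intCast, map_intCast, sub_eq_zero, halg] at h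
    exact h

/-! ### The congruence branch: a prime of a congruence modulus gives a congruent newform -/

/-- **A prime `ℓ` dividing Pasten's congruence modulus `η_{[χ₀]}(P)` is a congruence prime of
`f` with the newform of the class `P`.** Let `D₀` be a parametrisation datum of an elliptic `W₀/ℚ`
at level `N` (so `f = D₀.f` is the newform of `W₀`, with `ℤ`-valued system `χ₀`, `χ₀(T_p) =
a_p(W₀)`), `P ≠ 𝕀_{[χ₀]}` a minimal prime of `𝕋 = ℤ[T_p : p ∤ N]` and `ℓ` a prime dividing
`η_{[χ₀]}(P) = [ℤ : χ₀(P)]`. Then there are `M ∣ N` and a newform `g ∈ S₂(Γ₀(M))`, not the newform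
of `W₀`, together with a ring `R ⊆ ℂ` containing all `aₙ(g)`, a field `F` of characteristic `ℓ` and
`φ : R → F` with `φ(a_p(g)) = a_p(W₀)` for all primes `p ∤ M N ℓ`. Proof: `P` is the eigen-ideal of
an Atkin–Lehner form `[α_d] g`, `g` a newform of level `M`, `M d ∣ N`
(`exists_isNewform0_eigenIdeal_eq_of_mem_minimalPrimes`), i.e. `P = ker χ` for the system `χ` of
`[α_d] g`, `χ(T_p) = a_p(g)`; `ℓ ∣ η ∣ χ₀(t)` for `t ∈ P` (Pasten's Prop. 5.4,
`heckeCongruenceModulus_dvd_of_mem`), so `exists_ringHom_charP_of_dvd` applies; the `aₙ(g)` are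
algebraic integers (`IsNewform0.isIntegral_coeff_holds`); and `g` is not the newform of `W₀` since
otherwise `[α_d] g` and `f` would have the same `T_p`-eigenvalues `a_p(W₀)`, `p ∤ N`, hence the same
eigen-ideal (`eigenIdeal_eq_of_forall_heckeT_eq_smul`), contradicting `P ≠ 𝕀_{[χ₀]}`.
[cite: PastenShimura2024, §5.4 and Prop. 5.4 p. 17] -/
theorem exists_congruentNewform_of_dvd_heckeCongruenceModulus {N : ℕ} [NeZero N]
    {W₀ : WeierstrassCurve ℚ} (D₀ : ModularParametrizationData W₀ N)
    {P : Ideal (anemicHeckeRing N 2)} (hP : P ∈ minimalPrimes (anemicHeckeRing N 2))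
    (hne : P ≠ eigenIdeal D₀.f) {ℓ : ℕ} (hℓ : ℓ.Prime)
    (hdvd : ℓ ∣ heckeCongruenceModulus D₀.f P) :
    ∃ (M : ℕ) (_ : NeZero M) (g : CuspForm (Gamma0 M) 2), M ∣ N ∧ IsNewform0 g ∧
      ¬ IsNewformOf W₀ g ∧
      ∃ (R : Subring ℂ) (F : Type) (_ : Field F) (_ : CharP F ℓ) (φ : R →+* F)
        (hg : ∀ n : ℕ, cuspCoeff g n ∈ R),
        ∀ p : ℕ, p.Prime → ¬ (p ∣ M * N * ℓ) →
          φ ⟨cuspCoeff g p, hg p⟩ = ((W₀.LFunction p : ℤ) : F) := by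
  obtain ⟨x, g, hg, hu0, hPu⟩ := exists_isNewform0_eigenIdeal_eq_of_mem_minimalPrimes hP
  have hu : IsAnemicEigenvector (degeneracyMap0 x.1.1 N x.1.2 2 g) :=
    isAnemicEigenvector_degeneracyMap0 x hg
  have hf := D₀.hasIntegralEigenvalues_f
  have hf0 := D₀.f_ne_zero
  -- `χ(T_p) = a_p(g)` and `χ₀(T_p) = a_p(W₀)` for `p ∤ N`
  have hχT : ∀ (p : ℕ) (hp : p.Prime) (hpN : ¬ p ∣ N),
      eigencharacter hu hu0 (haveI : NeZero p := ⟨hp.ne_zero⟩; anemicHeckeRing.T N 2 p hp hpN) =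
        cuspCoeff g p := by
    intro p hp hpN
    haveI : NeZero p := ⟨hp.ne_zero⟩
    refine eigencharacter_eq_of_apply_eq_smul hu hu0 ?_
    rw [anemicHeckeRing.coe_T]
    exact heckeT_degeneracyMap0_eq_coeff_smul x hg p hp hpN
  have hfT : ∀ (p : ℕ) (hp : p.Prime),
      (haveI : NeZero p := ⟨hp.ne_zero⟩; heckeT (Gamma0 N) 2 p D₀.f) = (W₀.LFunction p : ℂ) • D₀.f := by
    intro p hp
    haveI : NeZero p := ⟨hp.ne_zero⟩
    rw [D₀.isNewformOf.1.heckeT_eq_coeff_smul hp]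
    exact congrArg (· • D₀.f) (D₀.isNewformOf.2 p)
  have hχ₀T : ∀ (p : ℕ) (hp : p.Prime) (hpN : ¬ p ∣ N),
      intEigencharacter hf hf0 (haveI : NeZero p := ⟨hp.ne_zero⟩; anemicHeckeRing.T N 2 p hp hpN) =
        W₀.LFunction p := by
    intro p hp hpN
    haveI : NeZero p := ⟨hp.ne_zero⟩
    apply Int.cast_injective (α := ℂ)
    rw [cast_intEigencharacter]
    refine eigencharacter_eq_of_apply_eq_smul _ hf0 ?_
    rw [anemicHeckeRing.coe_T]
    exact hfT p hp
  -- `ℓ ∣ η ∣ χ₀(t)` for `t ∈ P = ker χ`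
  have hdvd' : ∀ t ∈ RingHom.ker (eigencharacter hu hu0), (ℓ : ℤ) ∣ intEigencharacter hf hf0 t := by
    intro t ht
    have htP : t ∈ P := by rwa [hPu, eigenIdeal_eq_ker_eigencharacter hu hu0]
    exact (Int.natCast_dvd_natCast.mpr hdvd).trans (heckeCongruenceModulus_dvd_of_mem hf hf0 htP)
  obtain ⟨R, F, hF, hchar, φ, hint, hχR, hφ⟩ :=
    exists_ringHom_charP_of_dvd (intEigencharacter hf hf0) (eigencharacter hu hu0) hℓ hdvd'
  have hgR : ∀ n, cuspCoeff g n ∈ R := fun n ↦ hint _ (IsNewform0.isIntegral_coeff_holds hg n)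
  refine ⟨x.1.1, inferInstance, g, (dvd_mul_right _ _).trans x.2, hg, fun hWg ↦ hne ?_, R, F, hF,
    hchar, φ, hgR, fun p hp hpd ↦ ?_⟩
  · -- `g` the newform of `W₀` would force `P = 𝕀_{[χ₀]}`
    rw [hPu]
    refine eigenIdeal_eq_of_forall_heckeT_eq_smul hu hu0 hf.isAnemicEigenvector hf0
      fun p hp hpN ↦ ?_
    haveI : NeZero p := ⟨hp.ne_zero⟩
    refine ⟨(W₀.LFunction p : ℂ), ?_, hfT p hp⟩
    rw [heckeT_degeneracyMap0_eq_coeff_smul x hg p hp hpN]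
    exact congrArg (· • degeneracyMap0 x.1.1 N x.1.2 2 g) (hWg.2 p)
  · have hpN : ¬ p ∣ N := fun h ↦ hpd ((h.mul_left _).mul_right _)
    haveI : NeZero p := ⟨hp.ne_zero⟩
    have key := hφ (anemicHeckeRing.T N 2 p hp hpN)
    have heq : (⟨eigencharacter hu hu0 (anemicHeckeRing.T N 2 p hp hpN), hχR _⟩ : R) =
        ⟨cuspCoeff g p, hgR p⟩ := Subtype.ext (hχT p hp hpN)
    rw [heq, hχ₀T p hp hpN] at key
    exact key

/-- **The congruence branch** (from Pasten 2024, Thm. 5.5, the tree's named fact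
`PastenShimura2024_thm_5_5` = Ribet's `m_E ∣ r_E` followed by `r_E ∣ ∏ η`): if `D₀` is a datum of
minimal degree at level `N` in its class (the optimal parametrisation, `deg = δ_{1,N}`) of an
elliptic `W₀/ℚ`, then every prime `ℓ ∣ deg D₀` is a congruence prime of the newform of `W₀` with
another newform `g` of some level `M ∣ N`, in the residue-field form of the item: `ℓ` divides
`∏_{P ≠ 𝕀_{[χ₀]}} η_{[χ₀]}(P)`, hence some `η_{[χ₀]}(P)`, and
`exists_congruentNewform_of_dvd_heckeCongruenceModulus` applies.
[cite: PastenShimura2024, Thm. 5.5 p. 18] -/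
theorem congruenceBranch_of_thm_5_5 (h55 : PastenShimura2024_thm_5_5) {N : ℕ} [NeZero N]
    {W₀ : WeierstrassCurve ℚ} [W₀.IsElliptic] (D₀ : ModularParametrizationData W₀ N)
    (hmin : ∀ (W'' : WeierstrassCurve ℚ) [W''.IsElliptic] (D'' : ModularParametrizationData W'' N),
      D''.f = D₀.f → D₀.modularDegree ≤ D''.modularDegree)
    {ℓ : ℕ} (hℓ : ℓ.Prime) (hℓd : ℓ ∣ D₀.modularDegree) :
    ∃ (M : ℕ) (_ : NeZero M) (g : CuspForm (Gamma0 M) 2), M ∣ N ∧ IsNewform0 g ∧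
      ¬ IsNewformOf W₀ g ∧
      ∃ (R : Subring ℂ) (F : Type) (_ : Field F) (_ : CharP F ℓ) (φ : R →+* F)
        (hg : ∀ n : ℕ, cuspCoeff g n ∈ R),
        ∀ p : ℕ, p.Prime → ¬ (p ∣ M * N * ℓ) →
          φ ⟨cuspCoeff g p, hg p⟩ = ((W₀.LFunction p : ℤ) : F) := by
  classical
  have hprod := hℓd.trans (h55 N W₀ D₀ hmin)
  obtain ⟨P, hP, hℓP⟩ := (Prime.dvd_finsetProd_iff hℓ.prime _).mp hprod
  obtain ⟨hPne, hPmin⟩ := Finset.mem_erase.mp hP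
  exact exists_congruentNewform_of_dvd_heckeCongruenceModulus D₀
    ((finite_minimalPrimes_anemicHeckeRing N 2).mem_toFinset.mp hPmin) hPne hℓ hℓP

/-! ### The datum branch: a parametrisation whose extra prime factors are at most `163` -/

/-- Among the parametrisation data of a fixed curve `W` at level `N` there is one of minimal degree
(well-ordering of `ℕ`). [folklore] -/
theorem exists_minimal_datum {W : WeierstrassCurve ℚ} {N : ℕ} [NeZero N]
    (D : ModularParametrizationData W N) :
    ∃ D' : ModularParametrizationData W N,
      ∀ D'' : ModularParametrizationData W N, D'.modularDegree ≤ D''.modularDegree := by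
  classical
  have hex : ∃ n, ∃ D' : ModularParametrizationData W N, D'.modularDegree = n := ⟨_, D, rfl⟩
  obtain ⟨D', hD'⟩ := Nat.find_spec hex
  exact ⟨D', fun D'' ↦ hD' ▸ Nat.find_min' hex ⟨D'', rfl⟩⟩

/-- **The datum branch** (from the tree's named fact `PastenShimura2024_minimalDegree_le_163_mul`:
Mazur–Kenku, a minimal isogeny from the optimal curve has degree `≤ 163`). For a globally minimal
elliptic `W/ℚ` admitting some datum at level `N`, let `D'` be a datum of `W` of minimal degree and
`D₀` an optimal datum (`c₀ Λ_f = Λ_{E₀}`, of minimal degree in the whole class;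
`exists_optimalDatum'`, `modularDegree_le_of_isogenyMap_ker_eq_bot`) with the same newform. By
the degree formula `deg D' = [Λ_W : c Λ_f] · deg D₀` (`modularDegree_eq_card_ker_mul`) and the
fact, `[Λ_W : c Λ_f] ≤ 163`; so every prime factor of `deg D'` is `≤ 163` or divides `deg D₀`.
[cite: PastenShimura2024, §3 p. 13] -/
theorem datumBranch_of_le_163_mul (h163 : PastenShimura2024_minimalDegree_le_163_mul)
    {W : WeierstrassCurve ℚ} [W.IsElliptic] [W.IsGloballyMinimal] {N : ℕ} [NeZero N]
    (D : ModularParametrizationData W N) :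
    ∃ (D' : ModularParametrizationData W N) (W₀ : WeierstrassCurve ℚ) (_ : W₀.IsElliptic)
      (D₀ : ModularParametrizationData W₀ N),
      D₀.f = D'.f ∧
      (∀ (W'' : WeierstrassCurve ℚ) [W''.IsElliptic] (D'' : ModularParametrizationData W'' N),
        D''.f = D₀.f → D₀.modularDegree ≤ D''.modularDegree) ∧
      ∀ ℓ : ℕ, ℓ.Prime → ℓ ∣ D'.modularDegree → ℓ ≤ 163 ∨ ℓ ∣ D₀.modularDegree := by
  obtain ⟨D', hD'⟩ := exists_minimal_datum D
  obtain ⟨W₀, hW₀, D₀, hf₀, hlat⟩ := D'.exists_optimalDatum'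
  haveI := hW₀
  have hkerbot : D₀.isogenyMap.ker = ⊥ := D₀.isogenyMap_ker_eq_bot_iff.mpr hlat
  have hmin₀ : ∀ (W'' : WeierstrassCurve ℚ) [W''.IsElliptic] (D'' : ModularParametrizationData W'' N),
      D''.f = D₀.f → D₀.modularDegree ≤ D''.modularDegree :=
    fun W'' _ D'' hf ↦ D₀.modularDegree_le_of_isogenyMap_ker_eq_bot hkerbot D'' hf
  have hinj : Function.Injective D₀.isogenyMap := (AddMonoidHom.ker_eq_bot_iff _).mp hkerbot
  obtain ⟨hfin, hdeg⟩ := D'.modularDegree_eq_card_ker_mul hf₀.symm D₀.smul_periodLattice_le hinj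
    D₀.deg_pos D₀.finite_setOf_natCard_fiberOrbits_ne
  haveI := hfin
  have hmpos : 0 < Nat.card D'.isogenyMap.ker := Nat.card_pos
  have h163' : D'.modularDegree ≤ 163 * D₀.modularDegree := h163 N W₀ W D₀ D' hf₀.symm hmin₀ hD'
  have hm163 : Nat.card D'.isogenyMap.ker ≤ 163 := by
    rw [hdeg] at h163'
    exact Nat.le_of_mul_le_mul_right h163' D₀.deg_pos
  refine ⟨D', W₀, hW₀, D₀, hf₀, hmin₀, fun ℓ hℓ hℓd ↦ ?_⟩
  rw [hdeg] at hℓd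
  rcases (Nat.Prime.dvd_mul hℓ).mp hℓd with h | h
  · exact Or.inl ((Nat.le_of_dvd hmpos h).trans hm163)
  · exact Or.inr h

/-! ### Assembly -/

/-- **`DegreePrimeCongruence` (item stmt-ABC-14828 of route `IsogenyGlueCongruence`) from three
named facts of the tree**: modularity (`exists_isNewformOf`, BCDT 2001 Thm. A), Pasten's
spectral divisibility `δ_{1,N} ∣ ∏ η` (`PastenShimura2024_thm_5_5`, = Ribet's `m_E ∣ r_E`,
Agashe–Ribet–Stein 2012 Thm. 2.1, followed by the proved `r_f ∣ ∏ η`) and the Mazur–Kenku bound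
`deg_min ≤ 163 · δ_{1,N}` (`PastenShimura2024_minimalDegree_le_163_mul`). For a semistable (unused)
globally minimal elliptic `W/ℚ` of conductor `N`: modularity gives a datum, the datum branch a datum
`D'` of `W` and an optimal `D₀` with the same newform such that every prime `ℓ ∣ deg D'` is `≤ 163`
or divides `deg D₀`, and the congruence branch turns the latter into a congruence of `f_W` with
another newform `g` of level `M ∣ N` modulo a prime above `ℓ`; `W₀` and `W` have the same `aₙ`
(both equal `aₙ(f)`), so the statements transfer from `W₀` to `W`. The conclusion is the item's
signature verbatim. [cite: PastenShimura2024, Thm. 5.5 p. 18 and §3 p. 13] -/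
theorem degreePrimeCongruence_of_facts (hmod : exists_isNewformOf)
    (h55 : PastenShimura2024_thm_5_5) (h163 : PastenShimura2024_minimalDegree_le_163_mul) :
    ∀ (W : WeierstrassCurve ℚ) [W.IsElliptic] [W.IsGloballyMinimal] [NeZero (W.conductorNorm ℤ)], W.IsSemistable ℤ → ∃ D : Literature.NumberTheory.EllipticCurves.ModularForms.ModularParametrizationData W (W.conductorNorm ℤ), ∀ ℓ : ℕ, ℓ.Prime → ℓ ∣ D.modularDegree → ℓ ≤ 163 ∨ ∃ (M : ℕ) (_ : NeZero M) (g : CuspForm (CongruenceSubgroup.Gamma0 M) 2), M ∣ W.conductorNorm ℤ ∧ Literature.NumberTheory.EllipticCurves.ModularForms.IsNewform0 g ∧ ¬ Literature.NumberTheory.EllipticCurves.ModularForms.IsNewformOf W g ∧ ∃ (R : Subring ℂ) (F : Type) (_ : Field F) (_ : CharP F ℓ) (φ : R →+* F) (hg : ∀ n : ℕ, Literature.NumberTheory.EllipticCurves.ModularForms.cuspCoeff g n ∈ R), ∀ p : ℕ, p.Prime → ¬ (p ∣ M * W.conductorNorm ℤ * ℓ) → φ ⟨Literature.NumberTheory.EllipticCurves.ModularForms.cuspCoeff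 g p, hg p⟩ = ((W.LFunction p : ℤ) : F) := by
  intro W _ _ _ _
  obtain ⟨D⟩ := nonempty_modularParametrizationData_of_modularity hmod
    IsNewformOf.exists_maninConstant_modularDegree_holds W
  obtain ⟨D', W₀, hW₀, D₀, hf₀, hmin, hprimes⟩ := datumBranch_of_le_163_mul h163 D
  haveI := hW₀
  refine ⟨D', fun ℓ hℓ hℓd ↦ ?_⟩
  rcases hprimes ℓ hℓ hℓd with h163' | hℓ₀
  · exact Or.inl h163'
  right
  obtain ⟨M, hM, g, hMN, hg, hng, R, F, hF, hchar, φ, hgR, hcong⟩ :=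
    congruenceBranch_of_thm_5_5 h55 D₀ hmin hℓ hℓ₀
  -- `W₀` and `W` have the same `aₙ`, both being the coefficients of `D₀.f = D'.f`
  have hLF : ∀ n : ℕ, W₀.LFunction n = W.LFunction n := fun n ↦ by
    have h₀ := D₀.isNewformOf.2 n
    have h' := D'.isNewformOf.2 n
    rw [hf₀] at h₀
    exact_mod_cast h₀.symm.trans h'
  refine ⟨M, hM, g, hMN, hg, fun hWg ↦ hng ⟨hWg.1, fun n ↦ ?_⟩, R, F, hF, hchar, φ, hgR,
    fun p hp hpd ↦ ?_⟩
  · rw [hWg.2 n, hLF n]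
  · rw [hcong p hp hpd, hLF p]

/-- **`DegreePrimeCongruence` from modularity, Ribet's theorem and Mazur–Kenku**: the variant of
`degreePrimeCongruence_of_facts` with Pasten's Thm. 5.5 replaced by the tree's named fact
`modularDegree_dvd_congruenceNumber` (Agashe–Ribet–Stein 2012, Thm. 2.1, `m_E ∣ r_E`), through the
tree's theorem `PastenShimura2024_thm_5_5_of_modularDegree_dvd_congruenceNumber` (`r_f ∣ ∏ η` is
proved). [cite: AgasheRibetStein2012, Thm. 2.1] -/
theorem degreePrimeCongruence_of_ribet (hmod : exists_isNewformOf)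
    (hR : modularDegree_dvd_congruenceNumber) (h163 : PastenShimura2024_minimalDegree_le_163_mul) :
    ∀ (W : WeierstrassCurve ℚ) [W.IsElliptic] [W.IsGloballyMinimal] [NeZero (W.conductorNorm ℤ)], W.IsSemistable ℤ → ∃ D : Literature.NumberTheory.EllipticCurves.ModularForms.ModularParametrizationData W (W.conductorNorm ℤ), ∀ ℓ : ℕ, ℓ.Prime → ℓ ∣ D.modularDegree → ℓ ≤ 163 ∨ ∃ (M : ℕ) (_ : NeZero M) (g : CuspForm (CongruenceSubgroup.Gamma0 M) 2), M ∣ W.conductorNorm ℤ ∧ Literature.NumberTheory.EllipticCurves.ModularForms.IsNewform0 g ∧ ¬ Literature.NumberTheory.EllipticCurves.ModularForms.IsNewformOf W g ∧ ∃ (R : Subring ℂ) (F : Type) (_ : Field F) (_ : CharP F ℓ) (φ : R →+* F) (hg : ∀ n : ℕ, Literature.NumberTheory.EllipticCurves.ModularForms.cuspCoeff g n ∈ R), ∀ p : ℕ, p.Prime → ¬ (p ∣ M * W.conductorNorm ℤ * ℓ) → φ ⟨Literature.NumberTheory.EllipticCurves.ModularForms.cuspCoeff g p, hg p⟩ = ((W.LFunction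 p : ℤ) : F) :=
  degreePrimeCongruence_of_facts hmod
    (PastenShimura2024_thm_5_5_of_modularDegree_dvd_congruenceNumber hR) h163

end Summit.ABC.ABC.Theorems

end
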